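import Mathlib
import HarnessLib
import Summits.NavierStokesRegularity.NavierStokesRegularity.Theorems.PoloidalWindowRigidity.Negative.DriftProfile
import Literature.Algebra.EuclideanLattices.FccBccLattices

/-!
# Crux `PoloidalWindowRigidity` (K2, stmt-NavierStokesRegularity-19708) — negative side:
# the THREE-WAVE poloidal frozen field (kinematics)

Negative-side support (refuter seat ns-regularity-refuter1 gen 2, cell ns-regularity-ideate; D-0081 §C).

The THREE-WAVE FIELD `T = (∂₀φ, ∂₁φ, −∂₂φ)`, `φ = 2 sin(x₀+x₂) + 2 sin(x₁−x₂) + 2 sin(x₁+x₂)` (three solutions of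
`∂₂²φ = Δ_h φ`):  `T = (2cos u, 2cos w + 2cos p, −2cos u + 2cos w − 2cos p)`, `u = x₀+x₂`, `w = x₁−x₂`, `p = x₁+x₂`;
explicit derivative `triDeriv`, `div T = 0` (`triDeriv_trace`), `curl T = (−4 sin w + 4 sin p, −4 sin u, 0)` (poloidal
along `e₂`), bounds `‖T‖ ≤ 12`, `‖DT w‖ ≤ 24‖w‖`, `|curl T|² ≤ 80`.  The Type-I profile built on it (sequel
`…Negative.TriWaveProfile`) is the negative lane's witness for the rev-10 clause (vii) of the residue stub S2⁗.
WHAT THIS IS NOT: not a claim about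
Navier–Stokes — kinematics of an explicit profile; the crux K2 stays open. [folklore]
-/

noncomputable section

-- the summit and its single sub-problem share the name (CONVENTIONS §1), as in every Theorems file
set_option linter.dupNamespace false

namespace Summit.NavierStokesRegularity.NavierStokesRegularity.Theorems.PoloidalWindowRigidity.Negative

open MeasureTheory Set Function Filter Topology Metric
open scoped RealInnerProductSpace InnerProductSpace ENNReal NNReal
open Literature.Analysis Literature.Analysis.FluidPDE

local notation "E3" => EuclideanSpace ℝ (Fin 3)
local notation "π" i => (EuclideanSpace.proj (𝕜 := ℝ) (i : Fin 3) : EuclideanSpace ℝ (Fin 3) →L[ℝ] ℝ)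
local notation "𝐞" i => (EuclideanSpace.single (i : Fin 3) (1 : ℝ) : EuclideanSpace ℝ (Fin 3))

/-! ## The three-wave field -/

/-- The three-wave poloidal field `T = (2cos(x₀+x₂), 2cos(x₁−x₂) + 2cos(x₁+x₂), −2cos(x₀+x₂) + 2cos(x₁−x₂) − 2cos(x₁+x₂))`.
[folklore] -/
def triField (x : E3) : E3 :=
  (2 * Real.cos (x 0 + x 2)) • (𝐞 0) + (2 * Real.cos (x 1 - x 2) + 2 * Real.cos (x 1 + x 2)) • (𝐞 1) +
    (-(2 * Real.cos (x 0 + x 2)) + 2 * Real.cos (x 1 - x 2) - 2 * Real.cos (x 1 + x 2)) • (𝐞 2)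

/-- The derivative `DT(x)` as an explicit continuous linear map. [folklore] -/
def triDeriv (x : E3) : E3 →L[ℝ] E3 :=
  ((2 : ℝ) • (-(Real.sin (x 0 + x 2)) • ((π 0) + (π 2)))).smulRight (𝐞 0) +
  ((2 : ℝ) • (-(Real.sin (x 1 - x 2)) • ((π 1) - (π 2))) +
      (2 : ℝ) • (-(Real.sin (x 1 + x 2)) • ((π 1) + (π 2)))).smulRight (𝐞 1) +
  (-((2 : ℝ) • (-(Real.sin (x 0 + x 2)) • ((π 0) + (π 2)))) +
      (2 : ℝ) • (-(Real.sin (x 1 - x 2)) • ((π 1) - (π 2))) -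
      (2 : ℝ) • (-(Real.sin (x 1 + x 2)) • ((π 1) + (π 2)))).smulRight (𝐞 2)

/-- `T` is differentiable with derivative `triDeriv`. [folklore] -/
theorem hasFDerivAt_triField (x : E3) : HasFDerivAt triField (triDeriv x) x := by
  have h0 : HasFDerivAt (fun y : E3 => y 0) (π 0) x := (π 0).hasFDerivAt
  have h1 : HasFDerivAt (fun y : E3 => y 1) (π 1) x := (π 1).hasFDerivAt
  have h2 : HasFDerivAt (fun y : E3 => y 2) (π 2) x := (π 2).hasFDerivAt
  have hu := (Real.hasDerivAt_cos (x 0 + x 2)).comp_hasFDerivAt x (h0.add h2)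
  have hw := (Real.hasDerivAt_cos (x 1 - x 2)).comp_hasFDerivAt x (h1.sub h2)
  have hp := (Real.hasDerivAt_cos (x 1 + x 2)).comp_hasFDerivAt x (h1.add h2)
  have A := hu.const_mul (2 : ℝ)
  have B := (hw.const_mul (2 : ℝ)).add (hp.const_mul (2 : ℝ))
  have C := ((hu.const_mul (2 : ℝ)).neg.add (hw.const_mul (2 : ℝ))).sub (hp.const_mul (2 : ℝ))
  have H := ((A.smul_const (𝐞 0)).add (B.smul_const (𝐞 1))).add (C.smul_const (𝐞 2))
  exact H

/-- `DT = triDeriv`. [folklore] -/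
theorem fderiv_triField (x : E3) : fderiv ℝ triField x = triDeriv x :=
  (hasFDerivAt_triField x).fderiv

/-- `T` is continuous. [folklore] -/
theorem continuous_triField : Continuous triField := by
  have hd : Differentiable ℝ triField := fun x => (hasFDerivAt_triField x).differentiableAt
  exact hd.continuous

/-- The first component of `T`. [folklore] -/
theorem triField_apply_zero (x : E3) : triField x 0 = 2 * Real.cos (x 0 + x 2) := by
  simp [triField]

/-- The second component of `T`. [folklore] -/
theorem triField_apply_one (x : E3) : triField x 1 = 2 * Real.cos (x 1 - x 2) + 2 * Real.cos (x 1 + x 2) := by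
  simp [triField]

/-- The third component of `T`. [folklore] -/
theorem triField_apply_two (x : E3) :
    triField x 2 = -(2 * Real.cos (x 0 + x 2)) + 2 * Real.cos (x 1 - x 2) - 2 * Real.cos (x 1 + x 2) := by
  simp [triField]

/-- The first component of `DT(x) w`. [folklore] -/
theorem triDeriv_apply_zero (x w : E3) : triDeriv x w 0 = -2 * Real.sin (x 0 + x 2) * (w 0 + w 2) := by
  simp [triDeriv]
  ring

/-- The second component of `DT(x) w`. [folklore] -/
theorem triDeriv_apply_one (x w : E3) : triDeriv x w 1 =
    -2 * Real.sin (x 1 - x 2) * (w 1 - w 2) - 2 * Real.sin (x 1 + x 2) * (w 1 + w 2) := by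
  simp [triDeriv]
  ring

/-- The third component of `DT(x) w`. [folklore] -/
theorem triDeriv_apply_two (x w : E3) : triDeriv x w 2 =
    2 * Real.sin (x 0 + x 2) * (w 0 + w 2) - 2 * Real.sin (x 1 - x 2) * (w 1 - w 2) +
      2 * Real.sin (x 1 + x 2) * (w 1 + w 2) := by
  simp [triDeriv]
  ring

/-- **The vorticity of the three-wave field**: `curl T = (−4 sin w + 4 sin p, −4 sin u, 0)` — poloidal along `e₂`.
[folklore] -/
theorem curl_triField (x : E3) : curl triField x =
    (-4 * Real.sin (x 1 - x 2) + 4 * Real.sin (x 1 + x 2)) • (𝐞 0) + (-4 * Real.sin (x 0 + x 2)) • (𝐞 1) := by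
  ext i
  fin_cases i <;>
    simp [curl, fderiv_triField, triDeriv_apply_zero, triDeriv_apply_one, triDeriv_apply_two] <;> ring

/-- `div T = 0`. [folklore] -/
theorem triDeriv_trace (x : E3) : triDeriv x (𝐞 0) 0 + triDeriv x (𝐞 1) 1 + triDeriv x (𝐞 2) 2 = 0 := by
  rw [triDeriv_apply_zero, triDeriv_apply_one, triDeriv_apply_two]
  simp
  ring

/-! ## Bounds -/

/-- `|sin a · b| ≤ |b|`. [folklore] -/
theorem abs_sin_mul_le (a b : ℝ) : |Real.sin a * b| ≤ |b| := by
  rw [abs_mul]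
  have := mul_le_mul_of_nonneg_right (Real.abs_sin_le_one a) (abs_nonneg b)
  rwa [one_mul] at this

/-- `‖T(x)‖ ≤ 12`. [folklore] -/
theorem norm_triField_le (x : E3) : ‖triField x‖ ≤ 12 := by
  have hc0 := Real.abs_cos_le_one (x 0 + x 2)
  have hc1 := Real.abs_cos_le_one (x 1 - x 2)
  have hc2 := Real.abs_cos_le_one (x 1 + x 2)
  have e0 : ‖(𝐞 0)‖ = 1 := by simp
  have e1 : ‖(𝐞 1)‖ = 1 := by simp
  have e2 : ‖(𝐞 2)‖ = 1 := by simp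
  unfold triField
  refine (norm_add_le _ _).trans ?_
  refine (add_le_add (norm_add_le _ _) le_rfl).trans ?_
  rw [norm_smul, norm_smul, norm_smul, e0, e1, e2, mul_one, mul_one, mul_one, Real.norm_eq_abs,
    Real.norm_eq_abs, Real.norm_eq_abs]
  have h1 : |2 * Real.cos (x 0 + x 2)| ≤ 2 := by rw [abs_mul, abs_two]; linarith
  have h2 : |2 * Real.cos (x 1 - x 2) + 2 * Real.cos (x 1 + x 2)| ≤ 4 := by
    refine (abs_add_le _ _).trans ?_
    rw [abs_mul, abs_mul, abs_two]; linarith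
  have h3 : |-(2 * Real.cos (x 0 + x 2)) + 2 * Real.cos (x 1 - x 2) - 2 * Real.cos (x 1 + x 2)| ≤ 6 := by
    refine (abs_sub _ _).trans ?_
    refine (add_le_add (abs_add_le _ _) le_rfl).trans ?_
    rw [abs_neg, abs_mul, abs_mul, abs_mul, abs_two]; linarith
  linarith

/-- Pointwise bound for the derivative: `‖DT(x) w‖ ≤ 24‖w‖`. [folklore] -/
theorem norm_triDeriv_apply_le (x w : E3) : ‖triDeriv x w‖ ≤ 24 * ‖w‖ := by
  have hw : ∀ i : Fin 3, |w i| ≤ ‖w‖ := by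
    intro i
    have := PiLp.norm_apply_le w i
    rwa [Real.norm_eq_abs] at this
  have hv : triDeriv x w = (triDeriv x w 0) • (𝐞 0) + (triDeriv x w 1) • (𝐞 1) + (triDeriv x w 2) • (𝐞 2) := by
    ext i
    fin_cases i <;> simp
  have e0 : ‖(𝐞 0)‖ = 1 := by simp
  have e1 : ‖(𝐞 1)‖ = 1 := by simp
  have e2 : ‖(𝐞 2)‖ = 1 := by simp
  rw [hv]
  refine (norm_add_le _ _).trans ?_
  refine (add_le_add (norm_add_le _ _) le_rfl).trans ?_
  rw [norm_smul, norm_smul, norm_smul, e0, e1, e2, mul_one, mul_one, mul_one, Real.norm_eq_abs,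
    Real.norm_eq_abs, Real.norm_eq_abs, triDeriv_apply_zero, triDeriv_apply_one, triDeriv_apply_two]
  have hA : |-2 * Real.sin (x 0 + x 2) * (w 0 + w 2)| ≤ 2 * (|w 0| + |w 2|) := by
    rw [show -2 * Real.sin (x 0 + x 2) * (w 0 + w 2) = -2 * (Real.sin (x 0 + x 2) * (w 0 + w 2)) by ring, abs_mul]
    have := abs_sin_mul_le (x 0 + x 2) (w 0 + w 2)
    have := abs_add_le (w 0) (w 2)
    rw [abs_neg, abs_two]
    nlinarith
  have hB1 : |2 * Real.sin (x 1 - x 2) * (w 1 - w 2)| ≤ 2 * (|w 1| + |w 2|) := by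
    rw [show 2 * Real.sin (x 1 - x 2) * (w 1 - w 2) = 2 * (Real.sin (x 1 - x 2) * (w 1 - w 2)) by ring, abs_mul]
    have := abs_sin_mul_le (x 1 - x 2) (w 1 - w 2)
    have := abs_sub (w 1) (w 2)
    rw [abs_two]
    nlinarith
  have hB2 : |2 * Real.sin (x 1 + x 2) * (w 1 + w 2)| ≤ 2 * (|w 1| + |w 2|) := by
    rw [show 2 * Real.sin (x 1 + x 2) * (w 1 + w 2) = 2 * (Real.sin (x 1 + x 2) * (w 1 + w 2)) by ring, abs_mul]
    have := abs_sin_mul_le (x 1 + x 2) (w 1 + w 2)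
    have := abs_add_le (w 1) (w 2)
    rw [abs_two]
    nlinarith
  have hA' : |2 * Real.sin (x 0 + x 2) * (w 0 + w 2)| ≤ 2 * (|w 0| + |w 2|) := by
    rw [show 2 * Real.sin (x 0 + x 2) * (w 0 + w 2) = -(-2 * Real.sin (x 0 + x 2) * (w 0 + w 2)) by ring, abs_neg]
    exact hA
  have hc1 : |-2 * Real.sin (x 1 - x 2) * (w 1 - w 2) - 2 * Real.sin (x 1 + x 2) * (w 1 + w 2)| ≤
      4 * (|w 1| + |w 2|) := by
    rw [show -2 * Real.sin (x 1 - x 2) * (w 1 - w 2) - 2 * Real.sin (x 1 + x 2) * (w 1 + w 2) =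
      -(2 * Real.sin (x 1 - x 2) * (w 1 - w 2) + 2 * Real.sin (x 1 + x 2) * (w 1 + w 2)) by ring, abs_neg]
    have := abs_add_le (2 * Real.sin (x 1 - x 2) * (w 1 - w 2)) (2 * Real.sin (x 1 + x 2) * (w 1 + w 2))
    linarith
  have hc2 : |2 * Real.sin (x 0 + x 2) * (w 0 + w 2) - 2 * Real.sin (x 1 - x 2) * (w 1 - w 2) +
      2 * Real.sin (x 1 + x 2) * (w 1 + w 2)| ≤ 2 * (|w 0| + |w 2|) + 4 * (|w 1| + |w 2|) := by
    have h1 := abs_add_le (2 * Real.sin (x 0 + x 2) * (w 0 + w 2) - 2 * Real.sin (x 1 - x 2) * (w 1 - w 2))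
      (2 * Real.sin (x 1 + x 2) * (w 1 + w 2))
    have h2 := abs_sub (2 * Real.sin (x 0 + x 2) * (w 0 + w 2)) (2 * Real.sin (x 1 - x 2) * (w 1 - w 2))
    linarith
  have h0 := hw 0
  have h1 := hw 1
  have h2 := hw 2
  linarith [abs_nonneg (w 0), abs_nonneg (w 1), abs_nonneg (w 2)]

/-- `|curl T|² ≤ 80`. [folklore] -/
theorem curl_triField_sq_le (x : E3) :
    (-4 * Real.sin (x 1 - x 2) + 4 * Real.sin (x 1 + x 2)) ^ 2 + (-4 * Real.sin (x 0 + x 2)) ^ 2 ≤ 80 := by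
  have h0 := Real.sin_sq_le_one (x 0 + x 2)
  have h1 := Real.sin_sq_le_one (x 1 - x 2)
  have h2 := Real.sin_sq_le_one (x 1 + x 2)
  nlinarith [sq_nonneg (Real.sin (x 1 - x 2) + Real.sin (x 1 + x 2))]

end Summit.NavierStokesRegularity.NavierStokesRegularity.Theorems.PoloidalWindowRigidity.Negative

end
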